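import Summits.QuantumFields.YangMills.Theorems.BalabanUVNodesN15KingModelLandauFlux
import Summits.QuantumFields.YangMills.Theorems.BalabanUVNodesN15KingModelCurvatureLocal
import HarnessLib

/-!
# BalabanUVNodes ∕ N15 — THE KING-MODEL RUNG (PART Ϡ-d): THE η-RATE OF THE LANDAU CURVATURE MASS — in King's units `c = η⁻²` a FIXED physical field strength `B` is the lattice
# flux `θ = Bη²` per plaquette, and the Landau mass `η⁻²Λ(Bη²)` CONVERGES to `B∕2` at rate `η⁴` (`|η⁻²Λ(Bη²) − B∕2| ≤ B³η⁴∕12 + B⁴η⁶∕16`), is `≥ B∕4` UNIFORMLY in `η`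
# (`Bη² ≤ 1`), while PART Ϳ's plaquette mass `2η⁻²(2−2cos(Bη²∕4)) ≤ B²η²∕8` VANISHES — the curved case adds an η-UNIFORM mass to King's fine covariance layer, with an η-rate
# (Track A, DAG node N15 = NE2 «η-rates of the covariance ∕ background pieces»; FAN-OUT v1.1 §N15 s3 «KING-MODEL RUNG … + what the curved case adds»; count-neutral)

HONEST FRAMING.  Count-neutral (cell `pub-ymgap`, seat `pub-ymgap-dag-n15-e` g47; `--supports stmt-QuantumFields-27247 --as helper` = K3ᴬ, KEY MAP v3).  Real arithmetic on PART Ϡ-a's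
gap function plus its reading for King's covariant fine operator `−cΔ_U + m²` ([King1986] (4.4) p.670 with `c = η⁻²`; minimal coupling [Balaban1985BackgroundPropagators] (3.23)
p.394) at the constant-flux field of PART Ͻ-q.  The η-RATE here is for a SCALAR (the bottom of the covariant kinetic spectrum at fixed physical curvature), in the spirit of King's
printed rates ([King1986] Prop. 3.9 (3.73) p.665, Lemma 4.5 (4.38) p.674: objects at spacing `η` converge with a power of `η`); it is NOT the tree's kernel-level hypothesis shape
`T4EtaRate.EtaRateIneq342` (two spacings under a pairing) and NOT [Balaban1985BackgroundPropagators] (3.42); NOT Bałaban's `G_k(U)`; NOT a node discharge (N15 of record untouched);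
nothing continuum-YM ∕ ℝ⁴ ∕ OS ∕ Clay.  One finite torus per `η`; the flux quantisation `θ ∈ (2π∕K_{ν₀})ℤ` is implicit in `θ = p′_{ν₀}`.

THE RESULTS (`η > 0`, `B ≥ 0`, `Bη² ≤ 1` unless stated):
* §1 ★ `landauScaled_le_half` (`η⁻²Λ(Bη²) ≤ B∕2`), ★ `landauScaled_ge_poly` (`≥ B∕2 − B³η⁴∕12 − B⁴η⁶∕16`), ★★★ **`abs_landauScaled_sub_half_le`** (`|η⁻²Λ(Bη²) − B∕2| ≤ B³η⁴∕12 + B⁴η⁶∕16`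
  — THE η-RATE, order `η⁴`), ★★ **`landauScaled_ge_quarter`** (`η⁻²Λ(Bη²) ≥ B∕4`, η-UNIFORM), ★★ **`plaquetteScaled_lt_landauScaled`** (`B > 0`: Ϳ-l's `2η⁻²(2−2cos(Bη²∕4)) ≤ B²η²∕8 <
  B∕4 ≤ η⁻²Λ(Bη²)` — the Landau road wins at every admissible `η`), ★★★ **`tendsto_landauScaled`** (`η⁻²Λ(Bη²) → B∕2` as `η → 0⁺`: THE CONTINUUM LIMIT OF THE CURVATURE MASS EXISTS and is
  half the Landau level), `tendsto_plaquetteScaled` (Ϳ's mass `→ 0`).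
* §2 KING's OPERATOR IN PHYSICAL UNITS (`c > 0` the inverse squared spacing, `B := c·p′_{ν₀}` the flux per unit physical area; `U = fluxLink p ν₁`, `p_{ν₁} = 0`, `ν₀ ≠ ν₁`,
  `|p′_{ν₀}| ≤ 1`): ★★★ **`re_quadForm_covLapF_fluxLink_ge_physical`** (`(m² + |B|∕4)·Σ‖v_x‖² ≤ Re⟨v,(−cΔ_U+m²)v⟩` — an η-UNIFORM mass gap `|B|∕4` above `m²`), ★★
  **`re_quadForm_covLapF_fluxLink_ge_physical_rate`** (`m² + |B|∕2 − |B|³∕(12c²) − B⁴∕(16c³)`: the gap tends to `m² + |B|∕2` at rate `c⁻² = η⁴`), ★★ `eigenvalues_covLapF_fluxLink_ge_physical`,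
  ★★ `l2_opNorm_covLapF_fluxLink_massless_inv_le_physical` (`‖(−cΔ_U)⁻¹‖ ≤ 4∕|B|`, η-uniform: the massless charged covariance at fixed curvature is BOUNDED uniformly in the spacing — at
  `B = 0` it does not exist, Ͱ-d).
WHAT THE CURVED CASE ADDS, IN N15's CURRENCY (η-rates): at `A = 0` (King) and at torons (PARTS Ͷ∕Ͻ) the massless fine covariance has no η-uniform gap (zero modes ∕ holonomy gap
`→ 0` with the volume); at constant non-zero curvature it has the η-uniform gap `|B|∕4` (indeed `→ |B|∕2`, rate `η⁴`).  HONEST: `U(1)`, Landau gauge, fine covariance layer only; the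
true continuum Landau level is `|B|` (the factor `½` is the method's, Ϡ-a).
PRIOR TREE ART (by name): Ϡ-a (`landauGap`, `landauGap_le_half`, `landauGap_ge_poly`, `landauGap_ge_quarter`), Ϡ-c (`re_quadForm_covLapF_fluxLink_ge_landau`, `eigenvalues_covLapF_ge_of_coercive`,
`l2_opNorm_covLapF_inv_le_of_coercive`, `landauGap_sOf_pos`), Ϳ-l (`curvatureMass_scaling_le`), Ͱ-a∕b∕d (`covLapF`, `fib`, `isHermitian_covLapF`), Ͻ-q (`fluxLink`), `B5Prop11Plancherel` (`sOf`),
Mathlib (`squeeze_zero_norm'`, `tendsto_nhdsWithin_of_tendsto_nhds`, `Continuous.tendsto`).  Dedup (rg at filing): basename 0 files; needles `landauScaled|plaquetteScaled|_ge_physical|tendsto_landau` 0 tree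
files.  Locators: [King1986] (4.4) p.670, Prop. 3.9 (3.73) p.665, Lemma 4.5 (4.38) p.674 (η-rate templates); [Balaban1985BackgroundPropagators] (3.23) p.394, (3.35)–(3.37) p.397 (regular regime:
`|∂U − 1| = O(η²)`, i.e. `θ = Bη²`); [LandauLifshitzQM] §112 (Landau levels, notion only).  0 `sorry`, 0 `def`.
-/

noncomputable section
open scoped BigOperators ComplexConjugate ComplexOrder Topology
open Finset Matrix WithLp Filter

namespace Summit.QuantumFields.YangMills.BalabanUVNodes.N15KingModelRung.Landau

open Literature.MathematicalPhysics.QuantumFieldTheory.Balaban1983to89.B5Prop11Plancherel (Tor unitVec sOf)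
open Summit.QuantumFields.YangMills.BalabanUVNodes.N15KingModelRung.Covariant (covLapF fib isHermitian_covLapF)
open Summit.QuantumFields.YangMills.BalabanUVNodes.N15KingModelRung.Cover (fluxLink)
open Summit.QuantumFields.YangMills.BalabanUVNodes.N15KingModelRung.Curvature (curvatureMass_scaling_le)

/-! ## §1 The scaled gap `η⁻²Λ(Bη²)` and its η-rate -/

section Scaled

/-- ★ `η⁻²Λ(Bη²) ≤ B∕2` (`B ≥ 0`): the scaled Landau mass never exceeds half the Landau level. [folklore] -/
theorem landauScaled_le_half {η B : ℝ} (hη : 0 < η) (hB : 0 ≤ B) : η⁻¹ ^ 2 * landauGap (B * η ^ 2) ≤ B / 2 := by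
  have h := landauGap_le_half (B * η ^ 2)
  rw [abs_of_nonneg (by positivity)] at h
  have hη2 : 0 < η ^ 2 := by positivity
  calc η⁻¹ ^ 2 * landauGap (B * η ^ 2) ≤ η⁻¹ ^ 2 * (B * η ^ 2 / 2) := mul_le_mul_of_nonneg_left h (by positivity)
    _ = B / 2 := by field_simp

/-- ★ `η⁻²Λ(Bη²) ≥ B∕2 − B³η⁴∕12 − B⁴η⁶∕16` for `Bη² ≤ 1` (Ϡ-a `landauGap_ge_poly` rescaled). [folklore] -/
theorem landauScaled_ge_poly {η B : ℝ} (hη : 0 < η) (hB : 0 ≤ B) (hBη : B * η ^ 2 ≤ 1) :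
    B / 2 - B ^ 3 * η ^ 4 / 12 - B ^ 4 * η ^ 6 / 16 ≤ η⁻¹ ^ 2 * landauGap (B * η ^ 2) := by
  have h0 : 0 ≤ B * η ^ 2 := by positivity
  have h := landauGap_ge_poly (θ := B * η ^ 2) (by rwa [abs_of_nonneg h0])
  rw [abs_of_nonneg h0] at h
  have hη2 : 0 < η⁻¹ ^ 2 := by positivity
  calc B / 2 - B ^ 3 * η ^ 4 / 12 - B ^ 4 * η ^ 6 / 16 = η⁻¹ ^ 2 * (B * η ^ 2 / 2 - (B * η ^ 2) ^ 3 / 12 - (B * η ^ 2) ^ 4 / 16) := by field_simp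
    _ ≤ η⁻¹ ^ 2 * landauGap (B * η ^ 2) := mul_le_mul_of_nonneg_left h hη2.le

/-- ★★★ **THE η-RATE OF THE LANDAU CURVATURE MASS**: `|η⁻²Λ(Bη²) − B∕2| ≤ B³η⁴∕12 + B⁴η⁶∕16` (`B ≥ 0`, `Bη² ≤ 1`) — at fixed physical curvature `B` the lattice mass converges to
`B∕2` with the rate `η⁴` (King's template: objects at spacing `η` approach their limits with a power of `η`, [King1986] (3.73), (4.38)). [cite: King1986, (3.73) p.665, (4.38) p.674, (4.4) p.670] -/
theorem abs_landauScaled_sub_half_le {η B : ℝ} (hη : 0 < η) (hB : 0 ≤ B) (hBη : B * η ^ 2 ≤ 1) :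
    |η⁻¹ ^ 2 * landauGap (B * η ^ 2) - B / 2| ≤ B ^ 3 * η ^ 4 / 12 + B ^ 4 * η ^ 6 / 16 := by
  rw [abs_le]
  constructor
  · linarith [landauScaled_ge_poly hη hB hBη]
  · have h1 := landauScaled_le_half hη hB
    have h2 : 0 ≤ B ^ 3 * η ^ 4 / 12 + B ^ 4 * η ^ 6 / 16 := by positivity
    linarith

/-- ★★ **THE η-UNIFORM FLOOR**: `η⁻²Λ(Bη²) ≥ B∕4` (`B ≥ 0`, `Bη² ≤ 1`). [cite: King1986, (4.4) p.670] -/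
theorem landauScaled_ge_quarter {η B : ℝ} (hη : 0 < η) (hB : 0 ≤ B) (hBη : B * η ^ 2 ≤ 1) : B / 4 ≤ η⁻¹ ^ 2 * landauGap (B * η ^ 2) := by
  have h0 : 0 ≤ B * η ^ 2 := by positivity
  have h := landauGap_ge_quarter (θ := B * η ^ 2) (by rwa [abs_of_nonneg h0])
  rw [abs_of_nonneg h0] at h
  calc B / 4 = η⁻¹ ^ 2 * (B * η ^ 2 / 4) := by field_simp
    _ ≤ η⁻¹ ^ 2 * landauGap (B * η ^ 2) := mul_le_mul_of_nonneg_left h (by positivity)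

/-- ★★ **THE LANDAU ROAD BEATS THE PLAQUETTE ROAD AT EVERY ADMISSIBLE SPACING**: for `B > 0`, `Bη² ≤ 1`: `2η⁻²(2 − 2cos(Bη²∕4)) ≤ B²η²∕8 < B∕4 ≤ η⁻²Λ(Bη²)` (Ϳ-l `curvatureMass_scaling_le`:
PART Ϳ's mass vanishes in the continuum limit; PART Ϡ's does not). [cite: King1986, (4.4) p.670; Balaban1985BackgroundPropagators, (3.35) p.397] -/
theorem plaquetteScaled_lt_landauScaled {η B : ℝ} (hη : 0 < η) (hB : 0 < B) (hBη : B * η ^ 2 ≤ 1) :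
    2 * η⁻¹ ^ 2 * (2 - 2 * Real.cos (B * η ^ 2 / 4)) < η⁻¹ ^ 2 * landauGap (B * η ^ 2) := by
  have h1 := curvatureMass_scaling_le (B := B) hη
  have h2 := landauScaled_ge_quarter hη hB.le hBη
  have h3 : B ^ 2 * η ^ 2 / 8 < B / 4 := by
    have : B * η ^ 2 / 8 < 1 / 4 := by linarith
    calc B ^ 2 * η ^ 2 / 8 = B * (B * η ^ 2 / 8) := by ring
      _ < B * (1 / 4) := mul_lt_mul_of_pos_left this hB
      _ = B / 4 := by ring
  linarith

/-- ★★★ **THE CONTINUUM LIMIT OF THE CURVATURE MASS EXISTS AND IS HALF THE LANDAU LEVEL**: `η⁻²Λ(Bη²) → B∕2` as `η → 0⁺` (`B ≥ 0`). [cite: King1986, (4.4) p.670, (4.38) p.674] -/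
theorem tendsto_landauScaled {B : ℝ} (hB : 0 ≤ B) : Tendsto (fun η : ℝ => η⁻¹ ^ 2 * landauGap (B * η ^ 2)) (𝓝[>] 0) (𝓝 (B / 2)) := by
  -- the error majorant `B³η⁴∕12 + B⁴η⁶∕16 → 0`
  have hmaj : Tendsto (fun η : ℝ => B ^ 3 * η ^ 4 / 12 + B ^ 4 * η ^ 6 / 16) (𝓝[>] 0) (𝓝 0) := by
    have hc : Continuous fun η : ℝ => B ^ 3 * η ^ 4 / 12 + B ^ 4 * η ^ 6 / 16 := by continuity
    have h := hc.tendsto 0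
    simp only [zero_pow (by norm_num : (4 : ℕ) ≠ 0), zero_pow (by norm_num : (6 : ℕ) ≠ 0), mul_zero, zero_div, add_zero] at h
    exact tendsto_nhdsWithin_of_tendsto_nhds h
  -- eventually `0 < η` and `Bη² ≤ 1`
  have hev : ∀ᶠ η : ℝ in 𝓝[>] 0, 0 < η ∧ B * η ^ 2 ≤ 1 := by
    have h1 : ∀ᶠ η : ℝ in 𝓝[>] 0, 0 < η := self_mem_nhdsWithin
    have h2 : ∀ᶠ η : ℝ in 𝓝 (0 : ℝ), B * η ^ 2 ≤ 1 := by
      have hc : Continuous fun η : ℝ => B * η ^ 2 := by continuity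
      have ht := hc.tendsto 0
      simp only [zero_pow (by norm_num : (2 : ℕ) ≠ 0), mul_zero] at ht
      exact (ht.eventually (eventually_le_nhds zero_lt_one))
    exact h1.and (mem_nhdsWithin_of_mem_nhds h2)
  have hbound : ∀ᶠ η : ℝ in 𝓝[>] 0, ‖η⁻¹ ^ 2 * landauGap (B * η ^ 2) - B / 2‖ ≤ B ^ 3 * η ^ 4 / 12 + B ^ 4 * η ^ 6 / 16 :=
    hev.mono fun η h => by rw [Real.norm_eq_abs]; exact abs_landauScaled_sub_half_le h.1 hB h.2
  have h := squeeze_zero_norm' hbound hmaj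
  rw [← tendsto_sub_nhds_zero_iff]; exact h

/-- PART Ϳ's scaled plaquette mass tends to `0` as `η → 0⁺`: `2η⁻²(2−2cos(Bη²∕4)) → 0` (squeezed by `B²η²∕8`). [cite: Balaban1985BackgroundPropagators, (3.35) p.397] -/
theorem tendsto_plaquetteScaled (B : ℝ) : Tendsto (fun η : ℝ => 2 * η⁻¹ ^ 2 * (2 - 2 * Real.cos (B * η ^ 2 / 4))) (𝓝[>] 0) (𝓝 0) := by
  have hmaj : Tendsto (fun η : ℝ => B ^ 2 * η ^ 2 / 8) (𝓝[>] 0) (𝓝 0) := by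
    have hc : Continuous fun η : ℝ => B ^ 2 * η ^ 2 / 8 := by continuity
    have h := hc.tendsto 0
    simp only [zero_pow (by norm_num : (2 : ℕ) ≠ 0), mul_zero, zero_div] at h
    exact tendsto_nhdsWithin_of_tendsto_nhds h
  have hev : ∀ᶠ η : ℝ in 𝓝[>] 0, 0 < η := self_mem_nhdsWithin
  have hbound : ∀ᶠ η : ℝ in 𝓝[>] 0, ‖2 * η⁻¹ ^ 2 * (2 - 2 * Real.cos (B * η ^ 2 / 4))‖ ≤ B ^ 2 * η ^ 2 / 8 :=
    hev.mono fun η hη => by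
      have h0 : 0 ≤ 2 * η⁻¹ ^ 2 * (2 - 2 * Real.cos (B * η ^ 2 / 4)) :=
        mul_nonneg (by positivity) (by linarith [Real.cos_le_one (B * η ^ 2 / 4)])
      rw [Real.norm_eq_abs, abs_of_nonneg h0]
      exact curvatureMass_scaling_le hη
  exact squeeze_zero_norm' hbound hmaj

end Scaled

/-! ## §2 King's operator in physical units: an η-uniform curvature gap -/

section Physical

variable {d : ℕ} (K : Fin (d + 1) → ℕ) [hK : ∀ μ, NeZero (K μ)] {c : ℝ}

/-- ★★★ **AN η-UNIFORM MASS GAP FROM CURVATURE**: with `c > 0` the inverse squared spacing and `B := c·p′_{ν₀}` the flux per unit PHYSICAL area (`|p′_{ν₀}| ≤ 1`, i.e. `|B|η² ≤ 1` — the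
regular regime), at `U = fluxLink p ν₁` (`p_{ν₁} = 0`, `ν₀ ≠ ν₁`): `(m² + |B|∕4)·Σ_x‖v_x‖² ≤ Re⟨v,(−cΔ_U+m²)v⟩` for EVERY `m²` — a gap above `m²` independent of the spacing.
[cite: King1986, (4.4) p.670; Balaban1985BackgroundPropagators, (3.23) p.394, (3.35) p.397] -/
theorem re_quadForm_covLapF_fluxLink_ge_physical (hc : 0 < c) (m2 : ℝ) {p : Tor K} {ν₀ ν₁ : Fin (d + 1)} (hν : ν₀ ≠ ν₁) (hp : p ν₁ = 0) (hsmall : |sOf K p ν₀| ≤ 1)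
    (v : Tor K × Unit → ℂ) :
    (m2 + |c * sOf K p ν₀| / 4) * ∑ x, ‖fib K v x‖ ^ 2 ≤ (star v ⬝ᵥ (covLapF K c m2 (fluxLink K p ν₁) *ᵥ v)).re := by
  have h := re_quadForm_covLapF_fluxLink_ge_landau K hc.le m2 hν hp v
  have hq := landauGap_ge_quarter hsmall
  have hS : 0 ≤ ∑ x, ‖fib K v x‖ ^ 2 := Finset.sum_nonneg fun _ _ => sq_nonneg _
  have hB : |c * sOf K p ν₀| / 4 = c * (|sOf K p ν₀| / 4) := by rw [abs_mul, abs_of_pos hc]; ring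
  rw [hB]
  exact le_trans (mul_le_mul_of_nonneg_right (by nlinarith) hS) h

/-- ★★ **THE GAP WITH ITS η-RATE**: same setting, `0 ≤ p′_{ν₀}`: `(m² + B∕2 − B³∕(12c²) − B⁴∕(16c³))·Σ‖v_x‖² ≤ Re⟨v,(−cΔ_U+m²)v⟩`, `B = c·p′_{ν₀}` — with `c = η⁻²` the correction is
`B³η⁴∕12 + B⁴η⁶∕16`: the gap tends to `m² + B∕2` at rate `η⁴`. [cite: King1986, (4.4) p.670, (4.38) p.674] -/
theorem re_quadForm_covLapF_fluxLink_ge_physical_rate (hc : 0 < c) (m2 : ℝ) {p : Tor K} {ν₀ ν₁ : Fin (d + 1)} (hν : ν₀ ≠ ν₁) (hp : p ν₁ = 0) (hpos : 0 ≤ sOf K p ν₀)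
    (hsmall : sOf K p ν₀ ≤ 1) (v : Tor K × Unit → ℂ) :
    (m2 + (c * sOf K p ν₀ / 2 - (c * sOf K p ν₀) ^ 3 / (12 * c ^ 2) - (c * sOf K p ν₀) ^ 4 / (16 * c ^ 3))) * ∑ x, ‖fib K v x‖ ^ 2
      ≤ (star v ⬝ᵥ (covLapF K c m2 (fluxLink K p ν₁) *ᵥ v)).re := by
  have h := re_quadForm_covLapF_fluxLink_ge_landau K hc.le m2 hν hp v
  have hq := landauGap_ge_poly (θ := sOf K p ν₀) (by rwa [abs_of_nonneg hpos])
  rw [abs_of_nonneg hpos] at hq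
  have hS : 0 ≤ ∑ x, ‖fib K v x‖ ^ 2 := Finset.sum_nonneg fun _ _ => sq_nonneg _
  have heq : c * sOf K p ν₀ / 2 - (c * sOf K p ν₀) ^ 3 / (12 * c ^ 2) - (c * sOf K p ν₀) ^ 4 / (16 * c ^ 3)
      = c * (sOf K p ν₀ / 2 - sOf K p ν₀ ^ 3 / 12 - sOf K p ν₀ ^ 4 / 16) := by field_simp
  rw [heq]
  exact le_trans (mul_le_mul_of_nonneg_right (by nlinarith [mul_le_mul_of_nonneg_left hq hc.le]) hS) h

/-- ★★ Every eigenvalue is `≥ m² + |B|∕4`, `B = c·p′_{ν₀}`, uniformly in the spacing. [cite: King1986, (4.4) p.670] -/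
theorem eigenvalues_covLapF_fluxLink_ge_physical (hc : 0 < c) (m2 : ℝ) {p : Tor K} {ν₀ ν₁ : Fin (d + 1)} (hν : ν₀ ≠ ν₁) (hp : p ν₁ = 0) (hsmall : |sOf K p ν₀| ≤ 1) (i : Tor K × Unit) :
    m2 + |c * sOf K p ν₀| / 4 ≤ (isHermitian_covLapF K c m2 (fluxLink K p ν₁)).eigenvalues i :=
  eigenvalues_covLapF_ge_of_coercive K c m2 _ (fun v => re_quadForm_covLapF_fluxLink_ge_physical K hc m2 hν hp hsmall v) i

open scoped Matrix.Norms.L2Operator in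
/-- ★★ **THE MASSLESS CHARGED COVARIANCE AT FIXED CURVATURE IS BOUNDED UNIFORMLY IN THE SPACING**: `‖(−cΔ_U)⁻¹‖ ≤ 4∕|B|`, `B = c·p′_{ν₀} ≠ 0`, `|p′_{ν₀}| ≤ 1` (at `B = 0` the
inverse does not exist, PART Ͱ-d). [cite: Balaban1985BackgroundPropagators, (3.39) p.397; King1986, (4.4) p.670] -/
theorem l2_opNorm_covLapF_fluxLink_massless_inv_le_physical (hc : 0 < c) {p : Tor K} {ν₀ ν₁ : Fin (d + 1)} (hν : ν₀ ≠ ν₁) (hp : p ν₁ = 0) (hp0 : p ν₀ ≠ 0)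
    (hsmall : |sOf K p ν₀| ≤ 1) : ‖(covLapF K c 0 (fluxLink K p ν₁))⁻¹‖ ≤ 4 / |c * sOf K p ν₀| := by
  rw [abs_mul, abs_of_pos hc]
  exact l2_opNorm_covLapF_fluxLink_massless_inv_le_landau K hc hν hp hp0 hsmall

end Physical

end Summit.QuantumFields.YangMills.BalabanUVNodes.N15KingModelRung.Landau

end
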